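import Mathlib
import Literature.Computability.AlgebraicComplexity.LocalStrongUSP
import Literature.Computability.AlgebraicComplexity.PrattTrapezoidVal
import Literature.Computability.AlgebraicComplexity.PrattTrapezoidValSTPP
import Literature.Computability.AlgebraicComplexity.GroupTheoreticMatMulThmBProofs
import Summits.MatrixMultiplication.MatrixMultiplication.Theorems.SoloBlindPrattValCyclic
import Summits.MatrixMultiplication.MatrixMultiplication.Theorems.SoloBlindPrattValEventually

/-!
# Solo-blind seat, s45: `Val(ℤ/nℤ) ≥ |U|·(2t)^k` for `n ≥ (3t+1)^k` — balanced-digit embedding of USP puzzles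

Companion to `paper/SHARPEST.md` §3 Q12 (solo-blind seat `solo-MatrixMultiplication-blind`, session
s45, 2026-08-27).  Third kernel layer on K. Pratt's extremal quantity `Val` (arXiv:2309.03878, Def. 3.2;
tree `prattVal`), after `SoloBlindPrattValCyclic` (CRT, coprime mixed moduli) and
`SoloBlindPrattValEventually` (lifting lemma).

THE OBSERVATION.  In Cohn–Kleinberg–Szegedy–Umans' Theorem 33 (arXiv:math/0511460, §6.1) the STPP
family attached to a local strong USP `U ⊆ {1,2,3}^k` uses, in each coordinate, only the dichotomy
"zero / nonzero"; over the coordinate group `ℤ/(2t+1)` the nonzero residues are exactly the BALANCED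
digits `±1, …, ±t`.  Reading a vector of balanced digits in base `M = 3t+1`,
`ψ(x) = Σⱼ x̃ⱼ M^j` (`x̃ⱼ ∈ [−t, t]` the least absolute residue), one gets a map
`ψ : (ℤ/(2t+1))^k → ℤ/nℤ` (`n ≥ M^k`) which

* REFLECTS three-term zero sums (`ψa + ψb + ψc = 0 ⟹ a + b + c = 0`: a sum of three balanced digits
  has absolute value `≤ 3t < M`, so a vanishing balanced base-`M` expansion has all digits zero), hence
  carries the equilateral-trapezoid-free triple `(⋃ᵤ(Aᵤ−Bᵤ), ⋃ᵤ(Bᵤ−Cᵤ), ⋃ᵤ(Cᵤ−Aᵤ))` of Pratt's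
  Prop. 2.6/3.3 to an equilateral-trapezoid-free triple (lifting lemma `soloVal_etf_lift`);
* is injective, and KILLS NO INTENDED SOLUTION: on a triple `(x − y, y − z, z − x)` with
  `x ∈ Aᵤ, y ∈ Bᵤ, z ∈ Cᵤ` every coordinate carries exactly one nonzero entry `d` and the three digit
  sums are `d̃ + 0 + (−d)̃ = 0` (odd modulus), so the image triple still has `≥ |U|·(2t)^k` solutions.

Hence (kernel-checked below)

  `soloVal_prattVal_zmod_ge_balanced`:  `|U| · (2t)^k ≤ Val(ℤ/nℤ)` for every local strong USP `U` of
  width `k`, every `t`, and every `n ≥ (3t+1)^k`.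

Only THREE-term sums have to be reflected (Pratt's own transfer, proof of Thm. 4.4, moves the whole
STPP and therefore pays a factor `3` per cyclic factor; `Val` needs less), so the density loss per
coordinate is `2t/(3t+1) → 2/3`, which is BELOW the local-strong-USP rate: CKSU Prop. 18 + Prop. 34 give
local strong USPs of size `(2^{2/3} − o(1))^k = (1.5874… − o(1))^k`, and `2^{2/3} · 2t/(3t+1) > 1` for
`t ≥ 6`.  Pen consequence (SHARPEST §3 Q12, fourth layer; local strong USPs are closed under
concatenation, so every width is available): `Val(ℤ/nℤ) ≥ n^{1+δ−o(1)}` for ALL large `n`,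
`δ = max_t log(2^{2/3}·2t/(3t+1))/log(3t+1) ≈ 0.0101` (`t ≈ 33`).  Granting only the two published and
proved propositions of CKSU, this says that Pratt's Conjecture 4.1 (`∀ ε > 0, Val(ℤ_n) ≤ O(n^{1+ε})`,
the proposed obstruction to `ω = 2` via STPPs in `ℤ_q^ℓ`, `q` prime powers, Thm. 4.4, and in abelian
groups with boundedly many factors, Cor. 4.5) is FALSE, and that the conclusions of the conditional
Thm. 4.4 / Cor. 4.5 hold unconditionally (so they obstruct nothing).  The kernel theorem here is the
exact finite inequality for every puzzle; the asymptotic step (CKSU Props. 18, 34) is pen.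

Kernel-checked:
* `soloValB_abs_sum_le`, `soloValB_digits_eq_zero` — balanced base-`M` expansions: bound and uniqueness;
* `soloValB_reflect`, `soloValB_injective`, `soloValB_triple` — the three properties of `ψ`;
* `soloVal_prattVal_zmod_ge_balanced` — the theorem; `soloVal_prattVal_zmod_19_pow` — the width-3
  instance `2 · 12^3 = 3456 ≤ Val(ℤ/6859ℤ)` (`t = 6`, `U = {123, 231}`), for the record.

References: [Pratt2024] K. Pratt, arXiv:2309.03878, Def. 3.2, Props. 2.6, 3.3, Thm. 4.4, Conj. 4.1;
[CohnKleinbergSzegedyUmans2005] arXiv:math/0511460, §3 Prop. 18, §6 Thm. 33, Prop. 34.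
-/

set_option linter.dupNamespace false

namespace Summit.MatrixMultiplication.MatrixMultiplication.Theorems

open Finset Literature.Computability.AlgebraicComplexity Literature.Combinatorics.Additive

section Digits

/-- Balanced base-`b` expansions are bounded: `|Σ_{j<k} c_j b^j| ≤ b^k − 1` when `|c_j| ≤ b − 1`. -/
theorem soloValB_abs_sum_le (b : ℤ) (hb : 0 < b) : ∀ (k : ℕ) (c : Fin k → ℤ),
    (∀ j, |c j| ≤ b - 1) → |∑ j, c j * b ^ (j : ℕ)| ≤ b ^ k - 1 := by
  intro k
  induction k with
  | zero =>
    intro c _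
    simp
  | succ k ih =>
    intro c hc
    have hrest := ih (fun j => c j.succ) (fun j => hc j.succ)
    rw [Fin.sum_univ_succ]
    simp only [Fin.val_zero, pow_zero, mul_one, Fin.val_succ, pow_succ]
    have e : ∑ j : Fin k, c j.succ * (b ^ (j : ℕ) * b) =
        (∑ j : Fin k, c j.succ * b ^ (j : ℕ)) * b := by
      rw [Finset.sum_mul]
      exact Finset.sum_congr rfl fun j _ => by ring
    rw [e]
    calc |c 0 + (∑ j : Fin k, c j.succ * b ^ (j : ℕ)) * b|
        ≤ |c 0| + |(∑ j : Fin k, c j.succ * b ^ (j : ℕ)) * b| := abs_add_le _ _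
      _ = |c 0| + |∑ j : Fin k, c j.succ * b ^ (j : ℕ)| * b := by
          rw [abs_mul, abs_of_pos hb]
      _ ≤ (b - 1) + (b ^ k - 1) * b := by
          gcongr
          exact hc 0
      _ = b ^ k * b - 1 := by ring

/-- Balanced base-`b` expansions are unique: `Σ_{j<k} c_j b^j = 0` with `|c_j| ≤ b − 1` forces all
`c_j = 0`. -/
theorem soloValB_digits_eq_zero (b : ℤ) (hb : 0 < b) : ∀ (k : ℕ) (c : Fin k → ℤ),
    (∀ j, |c j| ≤ b - 1) → ∑ j, c j * b ^ (j : ℕ) = 0 → ∀ j, c j = 0 := by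
  intro k
  induction k with
  | zero =>
    intro c _ _ j
    exact Fin.elim0 j
  | succ k ih =>
    intro c hc hsum
    rw [Fin.sum_univ_succ] at hsum
    simp only [Fin.val_zero, pow_zero, mul_one, Fin.val_succ, pow_succ] at hsum
    have e : ∑ j : Fin k, c j.succ * (b ^ (j : ℕ) * b) =
        (∑ j : Fin k, c j.succ * b ^ (j : ℕ)) * b := by
      rw [Finset.sum_mul]
      exact Finset.sum_congr rfl fun j _ => by ring
    rw [e] at hsum
    have h0 : c 0 = 0 := by
      have hdvd : b ∣ c 0 := ⟨-(∑ j : Fin k, c j.succ * b ^ (j : ℕ)), by linarith⟩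
      exact Int.eq_zero_of_abs_lt_dvd hdvd ((hc 0).trans_lt (sub_one_lt b))
    have hS0 : ∑ j : Fin k, c j.succ * b ^ (j : ℕ) = 0 := by
      rw [h0, zero_add] at hsum
      rcases mul_eq_zero.1 hsum with h | h
      · exact h
      · exact absurd h hb.ne'
    have hrest := ih (fun j => c j.succ) (fun j => hc j.succ) hS0
    intro j
    exact Fin.cases h0 (fun i => hrest i) j

/-- The least absolute residue of `ℤ/(2t+1)` is a balanced digit: `|x̃| ≤ t`. -/
theorem soloValB_abs_valMinAbs_le (t : ℕ) (x : ZMod (2 * t + 1)) : |x.valMinAbs| ≤ (t : ℤ) := by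
  rw [Int.abs_eq_natAbs]
  have h := ZMod.natAbs_valMinAbs_le x
  exact_mod_cast h.trans (by omega)

/-- Odd modulus: the least absolute residue is odd under negation. -/
theorem soloValB_valMinAbs_neg (t : ℕ) (x : ZMod (2 * t + 1)) : (-x).valMinAbs = -x.valMinAbs :=
  ZMod.valMinAbs_neg_of_ne_half (by intro h; omega)

end Digits

section Embedding

/-- **Reflection of three-term zero sums.**  With `M = 3t+1` and `n ≥ M^k`, the balanced base-`M`
reading `x ↦ Σⱼ x̃ⱼ M^j (mod n)` of `(ℤ/(2t+1))^k` reflects `a + b + c = 0`. -/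
theorem soloValB_reflect (t k n : ℕ) (hn : (3 * t + 1) ^ k ≤ n) (a b c : Fin k → ZMod (2 * t + 1))
    (h : ((∑ j, (a j).valMinAbs * (3 * (t : ℤ) + 1) ^ (j : ℕ) : ℤ) : ZMod n) +
      ((∑ j, (b j).valMinAbs * (3 * (t : ℤ) + 1) ^ (j : ℕ) : ℤ) : ZMod n) +
      ((∑ j, (c j).valMinAbs * (3 * (t : ℤ) + 1) ^ (j : ℕ) : ℤ) : ZMod n) = 0) :
    a + b + c = 0 := by
  set s : Fin k → ℤ := fun j => (a j).valMinAbs + (b j).valMinAbs + (c j).valMinAbs with hs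
  have hcomb : (∑ j, (a j).valMinAbs * (3 * (t : ℤ) + 1) ^ (j : ℕ)) +
      (∑ j, (b j).valMinAbs * (3 * (t : ℤ) + 1) ^ (j : ℕ)) +
      (∑ j, (c j).valMinAbs * (3 * (t : ℤ) + 1) ^ (j : ℕ)) =
      ∑ j, s j * (3 * (t : ℤ) + 1) ^ (j : ℕ) := by
    rw [← Finset.sum_add_distrib, ← Finset.sum_add_distrib]
    exact Finset.sum_congr rfl fun j _ => by simp only [hs]; ring
  have hcast : (((∑ j, s j * (3 * (t : ℤ) + 1) ^ (j : ℕ) : ℤ)) : ZMod n) = 0 := by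
    rw [← hcomb]
    push_cast
    push_cast at h
    exact h
  have hdvd := (ZMod.intCast_zmod_eq_zero_iff_dvd _ _).1 hcast
  have hsb : ∀ j, |s j| ≤ (3 * (t : ℤ) + 1) - 1 := by
    intro j
    have h1 := soloValB_abs_valMinAbs_le t (a j)
    have h2 := soloValB_abs_valMinAbs_le t (b j)
    have h3 := soloValB_abs_valMinAbs_le t (c j)
    have := abs_add_three (a j).valMinAbs (b j).valMinAbs (c j).valMinAbs
    simp only [hs]
    linarith
  have hM : (0 : ℤ) < 3 * (t : ℤ) + 1 := by positivity
  have hbound := soloValB_abs_sum_le _ hM k s hsb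
  have hn' : (3 * (t : ℤ) + 1) ^ k ≤ (n : ℤ) := by exact_mod_cast hn
  have hzero : ∑ j, s j * (3 * (t : ℤ) + 1) ^ (j : ℕ) = 0 :=
    Int.eq_zero_of_abs_lt_dvd hdvd (by linarith)
  have hdig := soloValB_digits_eq_zero _ hM k s hsb hzero
  funext j
  have hj := hdig j
  simp only [hs] at hj
  have hj' := congrArg (fun z : ℤ => (z : ZMod (2 * t + 1))) hj
  simpa using hj'

/-- **Injectivity** of the balanced base-`M` reading modulo `n ≥ M^k`. -/
theorem soloValB_injective (t k n : ℕ) (hn : (3 * t + 1) ^ k ≤ n) :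
    Function.Injective fun x : Fin k → ZMod (2 * t + 1) =>
      ((∑ j, (x j).valMinAbs * (3 * (t : ℤ) + 1) ^ (j : ℕ) : ℤ) : ZMod n) := by
  intro x y hxy
  simp only at hxy
  rw [ZMod.intCast_eq_intCast_iff_dvd_sub] at hxy
  set d : Fin k → ℤ := fun j => (y j).valMinAbs - (x j).valMinAbs with hd
  have hcomb : (∑ j, (y j).valMinAbs * (3 * (t : ℤ) + 1) ^ (j : ℕ)) -
      (∑ j, (x j).valMinAbs * (3 * (t : ℤ) + 1) ^ (j : ℕ)) =
      ∑ j, d j * (3 * (t : ℤ) + 1) ^ (j : ℕ) := by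
    rw [← Finset.sum_sub_distrib]
    exact Finset.sum_congr rfl fun j _ => by simp only [hd]; ring
  rw [hcomb] at hxy
  have hdb : ∀ j, |d j| ≤ (3 * (t : ℤ) + 1) - 1 := by
    intro j
    have h1 := soloValB_abs_valMinAbs_le t (x j)
    have h2 := soloValB_abs_valMinAbs_le t (y j)
    have := abs_sub (y j).valMinAbs (x j).valMinAbs
    simp only [hd]
    linarith
  have hM : (0 : ℤ) < 3 * (t : ℤ) + 1 := by positivity
  have hbound := soloValB_abs_sum_le _ hM k d hdb
  have hn' : (3 * (t : ℤ) + 1) ^ k ≤ (n : ℤ) := by exact_mod_cast hn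
  have hzero : ∑ j, d j * (3 * (t : ℤ) + 1) ^ (j : ℕ) = 0 :=
    Int.eq_zero_of_abs_lt_dvd hxy (by linarith)
  have hdig := soloValB_digits_eq_zero _ hM k d hdb hzero
  funext j
  have hj := hdig j
  simp only [hd, sub_eq_zero] at hj
  exact (ZMod.valMinAbs_inj.1 hj).symm

/-- **The intended solutions survive.**  For `x ∈ A_u, y ∈ B_u, z ∈ C_u` (coordinate supports given
by the three symbols of one row `u`), the digit sums of `(x − y, y − z, z − x)` vanish coordinatewise,
so the images of the three differences sum to zero. -/
theorem soloValB_triple (t k n : ℕ) {L : ℕ} (row : Fin L → Fin k → Fin 3) (u : Fin L)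
    {x y z : Fin k → ZMod (2 * t + 1)} (hx : ∀ j, x j ≠ 0 ↔ row u j = 0)
    (hy : ∀ j, y j ≠ 0 ↔ row u j = 1) (hz : ∀ j, z j ≠ 0 ↔ row u j = 2) :
    ((∑ j, ((x - y) j).valMinAbs * (3 * (t : ℤ) + 1) ^ (j : ℕ) : ℤ) : ZMod n) +
      ((∑ j, ((y - z) j).valMinAbs * (3 * (t : ℤ) + 1) ^ (j : ℕ) : ℤ) : ZMod n) +
      ((∑ j, ((z - x) j).valMinAbs * (3 * (t : ℤ) + 1) ^ (j : ℕ) : ℤ) : ZMod n) = 0 := by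
  have h3 : ∀ a : Fin 3, a = 0 ∨ a = 1 ∨ a = 2 := by decide
  have hcoef : ∀ j, ((x - y) j).valMinAbs + ((y - z) j).valMinAbs + ((z - x) j).valMinAbs = 0 := by
    intro j
    have ex := hx j
    have ey := hy j
    have ez := hz j
    simp only [Pi.sub_apply]
    rcases h3 (row u j) with h | h | h <;>
      simp only [h, Fin.isValue, Fin.reduceEq, iff_true, iff_false, ne_eq, not_not] at ex ey ez
    · rw [ey, ez, sub_zero, sub_self, zero_sub, ZMod.valMinAbs_zero, soloValB_valMinAbs_neg]
      ring
    · rw [ex, ez, zero_sub, sub_zero, sub_self, ZMod.valMinAbs_zero, soloValB_valMinAbs_neg]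
      ring
    · rw [ex, ey, sub_self, zero_sub, sub_zero, ZMod.valMinAbs_zero, soloValB_valMinAbs_neg]
      ring
  have hcomb : (∑ j, ((x - y) j).valMinAbs * (3 * (t : ℤ) + 1) ^ (j : ℕ)) +
      (∑ j, ((y - z) j).valMinAbs * (3 * (t : ℤ) + 1) ^ (j : ℕ)) +
      (∑ j, ((z - x) j).valMinAbs * (3 * (t : ℤ) + 1) ^ (j : ℕ)) = 0 := by
    rw [← Finset.sum_add_distrib, ← Finset.sum_add_distrib]
    refine Finset.sum_eq_zero fun j _ => ?_
    have e : ((x - y) j).valMinAbs * (3 * (t : ℤ) + 1) ^ (j : ℕ) +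
        ((y - z) j).valMinAbs * (3 * (t : ℤ) + 1) ^ (j : ℕ) +
        ((z - x) j).valMinAbs * (3 * (t : ℤ) + 1) ^ (j : ℕ) =
        (((x - y) j).valMinAbs + ((y - z) j).valMinAbs + ((z - x) j).valMinAbs) *
          (3 * (t : ℤ) + 1) ^ (j : ℕ) := by ring
    rw [e, hcoef j, zero_mul]
  rw [← Int.cast_add, ← Int.cast_add, hcomb, Int.cast_zero]

end Embedding

section Main

/-- **`Val(ℤ/nℤ) ≥ |U| · (2t)^k` for `n ≥ (3t+1)^k`** — for every local strong USP `U` (`L` rows,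
width `k`) and every `t`: the STPP family of CKSU Thm. 33 over the coordinate group `ℤ/(2t+1)`
(balanced digits `±1, …, ±t`), read in base `3t+1`, is an equilateral-trapezoid-free triple in `ℤ/nℤ`
with at least `L · (2t)^k` solutions (Pratt 2024 Props. 2.6/3.3 + the lifting lemma). -/
theorem soloVal_prattVal_zmod_ge_balanced {k L : ℕ} {row : Fin L → Fin k → Fin 3}
    (hU : IsLocalStrongUSP row) (t : ℕ) (n : ℕ) [NeZero n] (hn : (3 * t + 1) ^ k ≤ n) :
    L * (2 * t) ^ k ≤ prattVal (ZMod n) := by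
  classical
  -- the STPP family over `(ℤ/(2t+1))^k`
  set A : Fin L → Finset (Fin k → ZMod (2 * t + 1)) :=
    fun a => univ.filter fun x => ∀ j, x j ≠ 0 ↔ row a j = 0 with hA
  set B : Fin L → Finset (Fin k → ZMod (2 * t + 1)) :=
    fun a => univ.filter fun x => ∀ j, x j ≠ 0 ↔ row a j = 1 with hB
  set C : Fin L → Finset (Fin k → ZMod (2 * t + 1)) :=
    fun a => univ.filter fun x => ∀ j, x j ≠ 0 ↔ row a j = 2 with hC
  have hmA : ∀ a x, x ∈ A a ↔ ∀ j, x j ≠ 0 ↔ row a j = 0 := fun a x => by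
    simp only [hA, mem_filter, mem_univ, true_and]
  have hmB : ∀ a x, x ∈ B a ↔ ∀ j, x j ≠ 0 ↔ row a j = 1 := fun a x => by
    simp only [hB, mem_filter, mem_univ, true_and]
  have hmC : ∀ a x, x ∈ C a ↔ ∀ j, x j ≠ 0 ↔ row a j = 2 := fun a x => by
    simp only [hC, mem_filter, mem_univ, true_and]
  have hS : IsSTPP A B C := soloVal_isSTPP_usp_mixed (K := fun _ => ZMod (2 * t + 1)) hU hmA hmB hmC
  have hS' : AddSimultaneousTPP A B C := (isSTPP_iff_addSimultaneousTPP _ _ _).1 hS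
  -- Pratt's quotient sets
  set QA : Finset (Fin k → ZMod (2 * t + 1)) := univ.biUnion fun i => ((A i) ×ˢ (B i)).image
    fun p : (Fin k → ZMod (2 * t + 1)) × (Fin k → ZMod (2 * t + 1)) => p.1 - p.2 with hQA
  set QB : Finset (Fin k → ZMod (2 * t + 1)) := univ.biUnion fun i => ((B i) ×ˢ (C i)).image
    fun p : (Fin k → ZMod (2 * t + 1)) × (Fin k → ZMod (2 * t + 1)) => p.1 - p.2 with hQB
  set QC : Finset (Fin k → ZMod (2 * t + 1)) := univ.biUnion fun i => ((C i) ×ˢ (A i)).image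
    fun p : (Fin k → ZMod (2 * t + 1)) × (Fin k → ZMod (2 * t + 1)) => p.1 - p.2 with hQC
  have hE : IsEquilateralTrapezoidFree QA QB QC :=
    isEquilateralTrapezoidFree_of_addSimultaneousTPP hS'
  -- the balanced base-(3t+1) reading
  set f : (Fin k → ZMod (2 * t + 1)) → ZMod n :=
    fun x => ((∑ j, (x j).valMinAbs * (3 * (t : ℤ) + 1) ^ (j : ℕ) : ℤ) : ZMod n) with hf
  have hrefl : ∀ a b c : Fin k → ZMod (2 * t + 1), f a + f b + f c = 0 → a + b + c = 0 :=
    fun a b c h => soloValB_reflect t k n hn a b c (by simpa only [hf] using h)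
  have hinj : Function.Injective f := by
    have h := soloValB_injective t k n hn
    simpa only [hf] using h
  have hE' : IsEquilateralTrapezoidFree (QA.image f) (QB.image f) (QC.image f) :=
    soloVal_etf_lift hE f f f (fun a _ b _ c _ h => hrefl a b c h)
  -- counting: the intended solutions `(x - y, y - z, z - x)` inject into the lifted zero sums
  have hterm : ∀ a : Fin L, #(A a) * #(B a) * #(C a) = (2 * t) ^ k := by
    intro a
    have e := soloVal_prod_three row a (fun _ => 2 * t)
    rw [Finset.prod_const, Finset.card_univ, Fintype.card_fin] at e
    rw [← e, hA, hB, hC]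
    simp only
    rw [soloVal_card_filter_support (K := fun _ => ZMod (2 * t + 1)) (fun j => row a j = 0),
      soloVal_card_filter_support (K := fun _ => ZMod (2 * t + 1)) (fun j => row a j = 1),
      soloVal_card_filter_support (K := fun _ => ZMod (2 * t + 1)) (fun j => row a j = 2)]
    simp only [ZMod.card, Nat.add_sub_cancel]
  have hsum : ∑ a : Fin L, #(A a) * #(B a) * #(C a) = L * (2 * t) ^ k := by
    simp only [hterm, Finset.sum_const, Finset.card_univ, Fintype.card_fin, smul_eq_mul]
  have hcount : ∑ a : Fin L, #(A a) * #(B a) * #(C a) ≤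
      #((QA ×ˢ QB ×ˢ QC).filter fun tt => f tt.1 + f tt.2.1 + f tt.2.2 = 0) := by
    set D : Finset (Σ _ : Fin L, (Fin k → ZMod (2 * t + 1)) × (Fin k → ZMod (2 * t + 1)) ×
        (Fin k → ZMod (2 * t + 1))) := univ.sigma fun i => A i ×ˢ B i ×ˢ C i with hD
    set Φ : (Σ _ : Fin L, (Fin k → ZMod (2 * t + 1)) × (Fin k → ZMod (2 * t + 1)) ×
        (Fin k → ZMod (2 * t + 1))) →
        (Fin k → ZMod (2 * t + 1)) × (Fin k → ZMod (2 * t + 1)) × (Fin k → ZMod (2 * t + 1)) :=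
      fun w => (w.2.1 - w.2.2.1, w.2.2.1 - w.2.2.2, w.2.2.2 - w.2.1) with hΦ
    have hmemD : ∀ w : Σ _ : Fin L, (Fin k → ZMod (2 * t + 1)) × (Fin k → ZMod (2 * t + 1)) ×
        (Fin k → ZMod (2 * t + 1)), w ∈ D ↔
        w.2.1 ∈ A w.1 ∧ w.2.2.1 ∈ B w.1 ∧ w.2.2.2 ∈ C w.1 := by
      rintro ⟨i, a, b, c⟩
      simp [hD]
    have hinjΦ : Set.InjOn Φ ↑D := by
      rintro ⟨i, a, b, c⟩ hx ⟨i', a', b', c'⟩ hy he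
      rw [Finset.mem_coe, hmemD] at hx hy
      simp only [hΦ, Prod.mk.injEq] at he
      obtain ⟨rfl, rfl, rfl⟩ := addSimultaneousTPP_sub_inj hS' hx.1 hx.2.1 hy.1 hy.2.1 hy.2.2 he.1
      have hc : c = c' := sub_right_injective he.2.1
      rw [hc]
    have hsub : D.image Φ ⊆
        (QA ×ˢ QB ×ˢ QC).filter fun tt => f tt.1 + f tt.2.1 + f tt.2.2 = 0 := by
      intro tt htt
      obtain ⟨⟨i, a, b, c⟩, hx, rfl⟩ := mem_image.1 htt
      rw [hmemD] at hx
      simp only at hx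
      rw [mem_filter, mem_product, mem_product]
      refine ⟨⟨?_, ?_, ?_⟩, ?_⟩
      · rw [hQA]; exact mem_biUnion_image_sub.2 ⟨i, a, hx.1, b, hx.2.1, rfl⟩
      · rw [hQB]; exact mem_biUnion_image_sub.2 ⟨i, b, hx.2.1, c, hx.2.2, rfl⟩
      · rw [hQC]; exact mem_biUnion_image_sub.2 ⟨i, c, hx.2.2, a, hx.1, rfl⟩
      · simp only [hΦ, hf]
        exact soloValB_triple t k n row i ((hmA i a).1 hx.1) ((hmB i b).1 hx.2.1)
          ((hmC i c).1 hx.2.2)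
    calc ∑ a : Fin L, #(A a) * #(B a) * #(C a) = #D := by
          rw [hD, card_sigma]
          simp only [card_product, mul_assoc]
      _ = #(D.image Φ) := (card_image_of_injOn hinjΦ).symm
      _ ≤ _ := card_le_card hsub
  calc L * (2 * t) ^ k = ∑ a : Fin L, #(A a) * #(B a) * #(C a) := hsum.symm
    _ ≤ #((QA ×ˢ QB ×ˢ QC).filter fun tt => f tt.1 + f tt.2.1 + f tt.2.2 = 0) := hcount
    _ ≤ #(zeroSumTriples (QA.image f) (QB.image f) (QC.image f)) :=
        soloVal_card_filter_le_card_zeroSumTriples_lift f f f hinj.injOn hinj.injOn hinj.injOn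
    _ ≤ prattVal (ZMod n) := card_zeroSumTriples_le_prattVal hE'

/-- **Record instance** (`t = 6`, the width-3 puzzle `{123, 231}`): `2 · 12^3 = 3456 ≤ Val(ℤ/19^3ℤ)`,
`19^3 = 6859`; the first parameter at which the density `2t/(3t+1) = 12/19` exceeds `2^{-2/3}`. -/
theorem soloVal_prattVal_zmod_19_pow : 3456 ≤ prattVal (ZMod 6859) := by
  have h := soloVal_prattVal_zmod_ge_balanced soloVal_isLocalStrongUSP_axesPair 6 6859 (by norm_num)
  simpa using h

/-- **Monotone form along all moduli**: for every local strong USP of `L` rows and width `k` and every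
`t`, ALL moduli `n ≥ (3t+1)^k` satisfy `L · (2t)^k ≤ Val(ℤ/nℤ)` (restated with `n + 1` to display the
quantifier over all positive moduli). -/
theorem soloVal_prattVal_zmod_ge_balanced' {k L : ℕ} {row : Fin L → Fin k → Fin 3}
    (hU : IsLocalStrongUSP row) (t : ℕ) :
    ∀ n : ℕ, (3 * t + 1) ^ k ≤ n + 1 → L * (2 * t) ^ k ≤ prattVal (ZMod (n + 1)) :=
  fun n hn => soloVal_prattVal_zmod_ge_balanced hU t (n + 1) hn

end Main

end Summit.MatrixMultiplication.MatrixMultiplication.Theorems
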